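import Literature.AlgebraicGeometry.Resolution.ArithmeticalThreefolds
import Literature.AlgebraicGeometry.Resolution.ResolutionProjectiveReduction
import Literature.AlgebraicGeometry.Resolution.AlterationsSemiStable
import Literature.AlgebraicGeometry.Resolution.StrictNormalCrossings
import HarnessLib

/-!
# GaloisWebClasses — Galois curve-webs (de Jong 1996 §4.16–4.22 made `G`-equivariant; phase 1 of «GaloisWeb»)

ROUTE-INDEPENDENT definitions module (no `Theses` import) for the decomp-res node GaloisWeb (lens-4 g6,
CRITIC-LEDGER row 41 CLEARED; source HOME/decomp-res-lens-4/g6/GaloisWeb.lean sha256 62269666…, critic's `lean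
check` rc 0).  It hosts the notions the route asides `Dominance.WebNormalForm / TameWebResolve / WildWebResolve /
EquivariantLogResolutionThree / EquivariantSemiStableResolution / WildQuotientResolutionFourClosed /
WildWebReduction / ResolutionDimFourAlgClosed` are stated over:

* `GaloisWeb f₂ π g D q h₁ G ρX ρY` — the WEB SITUATION: a regular integral projective base `Y/k` with snc
  divisor `D`; a finite group `G` acting on an integral normal `Y₂` with `π : Y₂ → Y` finite surjective
  `G`-invariant with orbit fibres, `G` faithful, `π` étale off `D`; an integral `X₂` with a `G`-equivariant
  semi-stable curve `f₂ : X₂ → Y₂` smooth over `π⁻¹(Y ∖ D)`; a finite surjective `G`-invariant generically étale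
  `q : X₂ → X₁` with orbit fibres onto an integral separated finite-type `k`-scheme (de Jong 1996 4.16–4.23,
  Abramovich–de Jong 1997 Situation 2.1);
* `TameStabilizers p ρY` (closed-point stabilisers of order prime to `p`), `HasWeb k X` (X is dominated by a web
  quotient), `HasTameWeb k p X`, and the kernel `HasTameWeb.hasWeb`.

The kernels file `Theorems/DominanceGaloisWeb.lean` proves closes / target_iff / root_of BY NAME.
[DeJong1996 §2.21–2.24, §4.11–4.23; AbramovichJong1996 §1.3.2, §2; SGA1 V.1.8, XIII.5.3]
-/

open CategoryTheory CategoryTheory.Limits AlgebraicGeometry TopologicalSpace Topology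
open Literature.AlgebraicGeometry.Resolution

namespace Summit.ResolutionOfSingularities.ResolutionOfSingularities.Theorems.GaloisWebClasses

/-! ## The web situation (de Jong 1996 §4.16–4.22 made `G`-equivariant, AdJ 1997 Situation 2.1) -/

/-- **Galois curve-web.** Data: a regular integral projective `k`-threefold-or-whatever `Y` with a
strict normal crossings divisor `D`; a finite group `G` acting (via `ρY`) on an integral NORMAL scheme
`Y₂` with a finite surjective `G`-invariant `π : Y₂ → Y` whose fibres are `G`-orbits, `G` acting
faithfully, `π` étale over `Y ∖ D` (i.e. `Y₂ = Nor(Y, L)`, `L/K(Y)` Galois with group `G`, unramified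
off `D`); an integral scheme `X₂` with a `G`-action `ρX` and a `G`-equivariant semi-stable curve
`f₂ : X₂ → Y₂` (de Jong 1996, 2.21) smooth over `π⁻¹(Y ∖ D)`; and a finite surjective `G`-invariant
`q : X₂ → X₁` onto an integral separated finite-type `k`-scheme whose fibres are the `G`-orbits and
which is generically étale (the quotient `X₂/G`, up to a finite birational map), everything over `k`.
[cite: DeJong1996, 4.16–4.23] (AbramovichJong1996 Situation 2.1) -/
structure GaloisWeb {k : Type} [Field k] {X₂ Y₂ Y X₁ : Scheme.{0}}
    (f₂ : X₂ ⟶ Y₂) (π : Y₂ ⟶ Y) (g : Y ⟶ Spec (.of k)) (D : Set Y)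
    (q : X₂ ⟶ X₁) (h₁ : X₁ ⟶ Spec (.of k))
    (G : Type) [Group G] [Finite G] (ρX : G →* Aut X₂) (ρY : G →* Aut Y₂) : Prop where
  /-- the base `Y` is integral -/
  isIntegral_base : IsIntegral Y
  /-- `Y` is projective over `k` -/
  isProjectiveOver_base : Literature.AlgebraicGeometry.Motives.IsProjectiveOver (Over.mk g)
  /-- `Y` is regular -/
  isRegular_base : Scheme.IsRegular Y
  /-- `D ⊂ Y` is a strict normal crossings divisor -/
  snc : IsStrictNormalCrossingsDivisor Y D
  /-- the cover `Y₂` is integral -/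
  isIntegral_cover : IsIntegral Y₂
  /-- `Y₂` is normal -/
  isNormal_cover : ∀ y : Y₂, IsIntegrallyClosed (Y₂.presheaf.stalk y)
  /-- `π` is finite -/
  isFinite_cover : IsFinite π
  /-- `π` is surjective -/
  surjective_cover : Function.Surjective π.base
  /-- `G` acts on `Y₂` over `Y` -/
  invariant_cover : ∀ σ : G, (ρY σ).hom ≫ π = π
  /-- the fibres of `π` are `G`-orbits -/
  transitive_cover : ∀ y y' : Y₂, π.base y = π.base y' → ∃ σ : G, (ρY σ).hom.base y = y'
  /-- `G` acts faithfully on `Y₂` (`G = Gal(L/K(Y))`) -/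
  faithful_cover : Function.Injective ρY
  /-- `π` is étale over `Y ∖ D` -/
  etale_cover : Etale (π ∣_ ⟨Dᶜ, snc.isClosed.isOpen_compl⟩)
  /-- the total space `X₂` is integral -/
  isIntegral_total : IsIntegral X₂
  /-- `f₂` is a semi-stable curve (de Jong 1996, 2.21) -/
  isSemiStableCurve : IsSemiStableCurve f₂
  /-- `f₂` is smooth over `π⁻¹(Y ∖ D)` -/
  smooth_off : Smooth (f₂ ∣_ (π ⁻¹ᵁ ⟨Dᶜ, snc.isClosed.isOpen_compl⟩))
  /-- `f₂` is `G`-equivariant -/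
  equivariant : ∀ σ : G, (ρX σ).hom ≫ f₂ = f₂ ≫ (ρY σ).hom
  /-- the quotient `X₁` is integral -/
  isIntegral_quot : IsIntegral X₁
  /-- `X₁ → Spec k` is separated -/
  isSeparated_quot : IsSeparated h₁
  /-- `X₁ → Spec k` is locally of finite type -/
  locallyOfFiniteType_quot : LocallyOfFiniteType h₁
  /-- `X₁ → Spec k` is quasi-compact -/
  quasiCompact_quot : QuasiCompact h₁
  /-- everything is over `k` -/
  comm : q ≫ h₁ = f₂ ≫ π ≫ g
  /-- `q` is finite -/
  isFinite_quot : IsFinite q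
  /-- `q` is surjective -/
  surjective_quot : Function.Surjective q.base
  /-- `q` is `G`-invariant -/
  invariant_quot : ∀ σ : G, (ρX σ).hom ≫ q = q
  /-- the fibres of `q` are `G`-orbits -/
  transitive_quot : ∀ x x' : X₂, q.base x = q.base x' → ∃ σ : G, (ρX σ).hom.base x = x'
  /-- `q` is generically étale -/
  genericallyEtale_quot : ∃ U : X₁.Opens, Dense (U : Set X₁) ∧ Etale (q ∣_ U)

/-- **Tame web**: every closed point of the base cover `Y₂` has a stabiliser of order prime to `p`
(then, `Y` being regular with snc branch divisor, `Y₂ → Y` is Kummer étale-locally by Abhyankar's lemma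
and all stabilisers on `Y₂` and `X₂` are abelian — AdJ 1997 §2.2 last paragraph, §2.3).
[cite: AbramovichJong1996, §1.3.2 and Rem. 2.10] (SGA1 XIII.5.3) -/
def TameStabilizers (p : ℕ) {Y₂ : Scheme.{0}} {G : Type} [Group G] (ρY : G →* Aut Y₂) : Prop :=
  ∀ y : Y₂, IsClosed ({y} : Set Y₂) → Nat.Coprime (Nat.card {σ : G // (ρY σ).hom.base y = y}) p

/-- `X/k` **is dominated by a Galois curve-web**: some web quotient `X₁` maps properly and
birationally onto `X`. [cite: DeJong1996, 4.16–4.22] (AbramovichJong1996 Situation 2.1) -/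
def HasWeb (k : Type) [Field k] (X : Scheme.{0}) : Prop :=
  ∃ (X₂ Y₂ Y X₁ : Scheme.{0}) (f₂ : X₂ ⟶ Y₂) (π : Y₂ ⟶ Y) (g : Y ⟶ Spec (.of k)) (D : Set Y)
    (q : X₂ ⟶ X₁) (h₁ : X₁ ⟶ Spec (.of k)) (G : Type) (_ : Group G) (_ : Finite G)
    (ρX : G →* Aut X₂) (ρY : G →* Aut Y₂) (φ : X₁ ⟶ X),
    GaloisWeb f₂ π g D q h₁ G ρX ρY ∧ IsProper φ ∧ IsBirational φ

/-- `X/k` **is dominated by a TAME Galois curve-web** (characteristic `p`).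
[cite: AbramovichJong1996, Rem. 2.10] -/
def HasTameWeb (k : Type) [Field k] (p : ℕ) (X : Scheme.{0}) : Prop :=
  ∃ (X₂ Y₂ Y X₁ : Scheme.{0}) (f₂ : X₂ ⟶ Y₂) (π : Y₂ ⟶ Y) (g : Y ⟶ Spec (.of k)) (D : Set Y)
    (q : X₂ ⟶ X₁) (h₁ : X₁ ⟶ Spec (.of k)) (G : Type) (_ : Group G) (_ : Finite G)
    (ρX : G →* Aut X₂) (ρY : G →* Aut Y₂) (φ : X₁ ⟶ X),
    GaloisWeb f₂ π g D q h₁ G ρX ρY ∧ TameStabilizers p ρY ∧ IsProper φ ∧ IsBirational φ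

/-- A tame web is a web. [folklore] -/
theorem HasTameWeb.hasWeb {k : Type} [Field k] {p : ℕ} {X : Scheme.{0}} (h : HasTameWeb k p X) :
    HasWeb k X := by
  obtain ⟨X₂, Y₂, Y, X₁, f₂, π, g, D, q, h₁, G, _, _, ρX, ρY, φ, hW, -, hφ, hbir⟩ := h
  exact ⟨X₂, Y₂, Y, X₁, f₂, π, g, D, q, h₁, G, inferInstance, inferInstance, ρX, ρY, φ, hW, hφ, hbir⟩

end Summit.ResolutionOfSingularities.ResolutionOfSingularities.Theorems.GaloisWebClasses
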